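import Mathlib

/-!
# Route `BECCellInformation` — support item `TwoScaleReduction` (stmt-AtomisticToContinuum-13443):
# the one-dimensional defective logarithmic Sobolev inequality

Helper file (`--supports stmt-AtomisticToContinuum-13443`). For a `C¹` function `g : ℝ → ℝ`,
`ε ≥ 0`, an interval `I = [a, a + s]` (`s > 0`) and `f = g² + ε`, with `r = ∫_I f`,
`J = ∫_I g'²`:

  `∫_I f log f ≤ r log (r / s) + r + s² J`                                    (`lsi_dim_one`)

i.e. the entropy of `f` with respect to the normalised Lebesgue measure on `I` is at most
`r + s² J` — a DEFECTIVE logarithmic Sobolev inequality for Lebesgue measure on an interval with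
the correct scaling `s²` in front of the Fisher-information term (the sharp, non-defective
inequality `Ent ≤ (2s²/π²) J` is Weissler's circle inequality after even reflection; the defective
form is all the two-scale reduction needs, since the defect `r` sums to the total mass).

Proof (elementary): `f` attains its minimum `f(t₀) ≤ r/s` on `I`; by the fundamental theorem of
calculus and `2|g g'| ≤ g²/s + s g'²`, `sup_I f ≤ f(t₀) + r/s + sJ ≤ 2r/s + sJ =: S`; hence
`∫_I f log f ≤ r log S = r log(r/s) + r log(2 + s²J/r) ≤ r log(r/s) + r + s²J` by `log x ≤ x - 1`.
-/

noncomputable section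

namespace Summit.AtomisticToContinuum.BoseEinsteinCondensation.Theorems

open MeasureTheory Set
open scoped ENNReal NNReal Topology

namespace TwoScaleReduction

/-- The final logarithmic bookkeeping of the 1-D inequality: for `r, J ≥ 0`, `s > 0`,
`r log(2r/s + sJ) ≤ r log(r/s) + r + s²J` (from `log(2 + x) ≤ 1 + x`). [folklore] -/
theorem mul_log_sup_le {r s J : ℝ} (hr : 0 ≤ r) (hs : 0 < s) (hJ : 0 ≤ J) :
    r * Real.log (2 * r / s + s * J) ≤ r * Real.log (r / s) + r + s ^ 2 * J := by
  rcases hr.eq_or_lt with h | hr'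
  · have h0 : 0 ≤ s ^ 2 * J := by positivity
    rw [← h]; simpa using h0
  have hrs : 0 < r / s := div_pos hr' hs
  have hx : 0 < 2 + s ^ 2 * J / r := by positivity
  have h1 : 2 * r / s + s * J = (r / s) * (2 + s ^ 2 * J / r) := by field_simp
  rw [h1, Real.log_mul hrs.ne' hx.ne']
  have h2 : Real.log (2 + s ^ 2 * J / r) ≤ (2 + s ^ 2 * J / r) - 1 := Real.log_le_sub_one_of_pos hx
  have h3 : r * ((2 + s ^ 2 * J / r) - 1) = r + s ^ 2 * J := by field_simp; ring
  have h4 := mul_le_mul_of_nonneg_left h2 hr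
  rw [h3] at h4
  linarith [h4]

/-- Pointwise AM–GM used under the integral: `|2 g g'| ≤ g²/s + s g'²` (`s > 0`). [folklore] -/
theorem abs_two_mul_mul_le {x y s : ℝ} (hs : 0 < s) :
    |2 * x * y| ≤ x ^ 2 / s + s * y ^ 2 := by
  have key : 2 * s * (|x| * |y|) ≤ x ^ 2 + s ^ 2 * y ^ 2 := by
    nlinarith [sq_nonneg (|x| - s * |y|), sq_abs x, sq_abs y]
  have habs : |2 * x * y| = 2 * (|x| * |y|) := by
    rw [abs_mul, abs_mul, abs_two, mul_assoc]
  rw [habs, div_add' _ _ _ hs.ne', le_div_iff₀ hs]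
  nlinarith [key]

/-- **The one-dimensional defective logarithmic Sobolev inequality.** For `g : ℝ → ℝ` with a
continuous derivative `g'`, `ε ≥ 0`, `s > 0` and `f = g² + ε` on `I = [a, a+s]`:
`∫_I f log f ≤ r log(r/s) + r + s² ∫_I g'²`, `r = ∫_I f`. [folklore] -/
theorem lsi_dim_one {g g' : ℝ → ℝ} (hg : ∀ t, HasDerivAt g (g' t) t) (hg' : Continuous g')
    {ε : ℝ} (hε : 0 ≤ ε) (a : ℝ) {s : ℝ} (hs : 0 < s) :
    ∫ t in Icc a (a + s), (g t ^ 2 + ε) * Real.log (g t ^ 2 + ε) ≤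
      (∫ t in Icc a (a + s), (g t ^ 2 + ε)) *
          Real.log ((∫ t in Icc a (a + s), (g t ^ 2 + ε)) / s) +
        (∫ t in Icc a (a + s), (g t ^ 2 + ε)) + s ^ 2 * ∫ t in Icc a (a + s), g' t ^ 2 := by
  set I := Icc a (a + s) with hIdef
  set f : ℝ → ℝ := fun t => g t ^ 2 + ε with hf
  have hgc : Continuous g := continuous_iff_continuousAt.2 fun t => (hg t).continuousAt
  have hfc : Continuous f := by rw [hf]; fun_prop
  have hI : IsCompact I := isCompact_Icc
  have hIm : MeasurableSet I := measurableSet_Icc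
  have hvolI : volume.real I = s := by
    rw [measureReal_def, hIdef, Real.volume_Icc, ENNReal.toReal_ofReal (by linarith)]
    ring
  have hf0 : ∀ t, 0 ≤ f t := fun t => by rw [hf]; positivity
  have hint : ∀ {φ : ℝ → ℝ}, Continuous φ → IntegrableOn φ I volume := fun hφ =>
    hφ.continuousOn.integrableOn_compact hI
  -- the three integrals
  set r := ∫ t in I, f t with hr
  set J := ∫ t in I, g' t ^ 2 with hJ
  have hJ0 : 0 ≤ J := setIntegral_nonneg hIm fun t _ => sq_nonneg _
  have hr0 : 0 ≤ r := setIntegral_nonneg hIm fun t _ => hf0 t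
  have hg2r : ∫ t in I, g t ^ 2 ≤ r :=
    setIntegral_mono_on (hint (by fun_prop)) (hint hfc) hIm fun t _ => by
      show g t ^ 2 ≤ g t ^ 2 + ε; linarith
  -- minimum of `f` on `I`
  obtain ⟨t₀, ht₀I, ht₀⟩ :=
    hI.exists_isMinOn (nonempty_Icc.2 (by linarith)) hfc.continuousOn
  have hmin : f t₀ ≤ r / s := by
    rw [le_div_iff₀ hs]
    have h1 : ∫ _ in I, f t₀ = f t₀ * s := by
      rw [setIntegral_const, hvolI, smul_eq_mul, mul_comm]
    rw [← h1]
    exact setIntegral_mono_on (hint continuous_const) (hint hfc) hIm fun t ht => ht₀ ht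
  -- derivative of `f`
  have hfd : ∀ t, HasDerivAt f (2 * g t * g' t) t := by
    intro t
    have h := ((hg t).pow 2).add_const ε
    rw [hf]
    refine h.congr_deriv ?_
    norm_num
  have hdc : Continuous fun x => 2 * g x * g' x := by fun_prop
  -- the sup bound on `I`
  have hsup : ∀ t ∈ I, f t ≤ 2 * r / s + s * J := by
    intro t ht
    have hFTC : ∫ x in t₀..t, 2 * g x * g' x = f t - f t₀ :=
      intervalIntegral.integral_eq_sub_of_hasDerivAt (fun x _ => hfd x)
        (hdc.intervalIntegrable _ _)
    have hsub : Set.uIoc t₀ t ⊆ I := uIoc_subset_uIcc.trans (uIcc_subset_Icc ht₀I ht)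
    have hle : f t - f t₀ ≤ ∫ x in I, |2 * g x * g' x| := by
      rw [← hFTC]
      calc ∫ x in t₀..t, 2 * g x * g' x ≤ ‖∫ x in t₀..t, 2 * g x * g' x‖ := Real.le_norm_self _
        _ ≤ ∫ x in Set.uIoc t₀ t, ‖2 * g x * g' x‖ := intervalIntegral.norm_integral_le_integral_norm_uIoc
        _ ≤ ∫ x in I, ‖2 * g x * g' x‖ :=
            setIntegral_mono_set (hint hdc).norm (Filter.Eventually.of_forall fun x => norm_nonneg _)
              hsub.eventuallyLE
        _ = ∫ x in I, |2 * g x * g' x| := rfl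
    have hamgm : ∫ x in I, |2 * g x * g' x| ≤ ∫ x in I, (g x ^ 2 / s + s * g' x ^ 2) :=
      setIntegral_mono_on (hint hdc).norm (hint (by fun_prop)) hIm fun x _ =>
        abs_two_mul_mul_le hs
    have hsplit : ∫ x in I, (g x ^ 2 / s + s * g' x ^ 2) = (∫ x in I, g x ^ 2) / s + s * J := by
      rw [integral_add, integral_div, integral_const_mul]
      · exact (hint (by fun_prop)).div_const _
      · exact (hint (by fun_prop)).const_mul _
    have h3 : (∫ x in I, g x ^ 2) / s ≤ r / s := div_le_div_of_nonneg_right hg2r hs.le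
    calc f t ≤ f t₀ + ∫ x in I, |2 * g x * g' x| := by linarith
      _ ≤ r / s + ((∫ x in I, g x ^ 2) / s + s * J) := by rw [← hsplit]; exact add_le_add hmin hamgm
      _ ≤ r / s + (r / s + s * J) := by linarith
      _ = 2 * r / s + s * J := by ring
  -- pointwise `f log f ≤ f log S` on `I`
  set S := 2 * r / s + s * J with hS
  have hpt : ∀ t ∈ I, f t * Real.log (f t) ≤ f t * Real.log S := by
    intro t ht
    rcases (hf0 t).eq_or_lt with h | h
    · rw [← h]; simp
    · exact mul_le_mul_of_nonneg_left (Real.log_le_log h (hsup t ht)) (hf0 t)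
  have hflogf : Continuous fun t => f t * Real.log (f t) := Real.continuous_mul_log.comp hfc
  calc ∫ t in I, f t * Real.log (f t) ≤ ∫ t in I, f t * Real.log S :=
        setIntegral_mono_on (hint hflogf) (hint (hfc.mul continuous_const)) hIm hpt
    _ = r * Real.log S := by rw [integral_mul_const]
    _ ≤ r * Real.log (r / s) + r + s ^ 2 * J := mul_log_sup_le hr0 hs hJ0

end TwoScaleReduction

end Summit.AtomisticToContinuum.BoseEinsteinCondensation.Theorems
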